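import Literature.Barriers.BirchSwinnertonDyer.PAdicFunctionalEquationSharpFlatTwoProofs
import HarnessLib

/-!
# PARITY(2) at a supersingular `2` with `a₂ = 0`: `λ♯ ≡ c`, `λ♭ ≡ c + 1 (mod 2)`,
# i.e. `(−1)^{λ♯} = χ₈(N_E) = −(−1)^{λ♭}` (proofs only)

A *proofs* companion (theorems only; no definition, no named fact) of
`PAdicFunctionalEquationParityLambdaTwoProofs` (the ORDINARY `2` case: `(−1)^λ = χ₈(N_E)` for
`L₂(E,T)`) and of `PAdicFunctionalEquationSharpFlatTwoProofs` (the functional equations of Sprung's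
pair). Let `E = W/ℚ` be globally minimal with good SUPERSINGULAR reduction at `2` and `a₂(E) = 0`,
`f ∈ S₂(Γ₀(N))` its newform (`2 ∤ N`), and `(L♯, L♭) ∈ ℤ₂⟦T⟧²` Sprung's pair
(`IsSprungPair f 2 0 L♯ L♭`; `exists_isSprungPair_two`, unique by `IsSprungPair.unique`). The
functional equations (`exists_functionalEquation_sharp_flat_two`)

  `L♯(T^ι) = σ(1+T)^{c − 2/3}L♯(T)`, `L♭(T^ι) = σ(1+T)^{c − 1/3}L♭(T)`, `N ≡ η_N 5^c`, `σ = ±1`,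

fed to the core `norm_natCast_sub_le_of_subst_invOnePlusSubOne_eq` ("at `p = 2` the functional
equation `g(T^ι) = σ(1+T)^x g` forces `n ≡ x (mod 2)` for the index `n` of the first unit
coefficient of a `2`-integral `g`") give, with `−2/3` EVEN and `−1/3` ODD in `ℤ₂` and
`5^c ≡ 1 (mod 8) ↔ c` even, `η_N = ±1`:

* `even_firstUnitCoeff_sharp_iff_mod_eight`: the first unit coefficient index `n♯` of `t·L♯`
  (any normalising scalar `t ∈ ℚ₂`, e.g. `t = 2^{−μ(L♯)}`, when `n♯ = λ(L♯)`) is EVEN iff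
  `N ≡ ±1 (mod 8)`;
* `even_firstUnitCoeff_flat_iff_mod_eight`: `n♭` is even iff `N ≡ ±3 (mod 8)`;
* `odd_firstUnitCoeff_sharp_add_flat`: hence `n♯ + n♭` is ODD — the root number does not enter;
* `…_of_mu_zero` versions with `t = 1` (`L♯, L♭ ∈ Λ` have integral coefficients).

STATUS: consequences of printed results (Sprung 2017, Cor. 4.14: the functional equation with the
units `W^± = (1+T)^{2/3}, (1+T)^{1/3}` at `p = 2`; Greenberg LNM 1716 §1 and p. 181: sign = root
number, second fixed point `−2` of `ι` at `p = 2`); the `λ♯/λ♭ mod 2` reading is not printed as such.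
The same parity law at `μ = 0`, uniformly for `a₂ ∈ {0, ±2}` and by a different mechanism (the second
coefficient of the Mazur–Tate functional equation modulo `2`, o1 lens-1 GEN 8), is the summit-side
`Summits/BirchSwinnertonDyer/Rank1Residual/Supersingular/SignedLambdaParityTwo.lean`
(`even_lam_sharp_two_iff`); the present file covers `a₂ = 0` only but with an arbitrary normalising
scalar `t` (no `μ = 0` hypothesis), directly from the functional equations of `L♯, L♭`.
Requested by the residual cell `b2b-bsdres`, class O1 (X5, `p = 2`, non-CM), o1 lead typer queue
v3.4a item (23) "PARITY(2) at `a₂ = 0`" (R-G17.6; lens-1 R-L1-G6-B, refuter §56(1)).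

## References

* F. Sprung, *On pairs of `p`-adic `L`-functions for weight-two modular forms*, Algebra & Number
  Theory 11 (2017), Thm. 1.12, Cor. 4.4, §3.5 and Cor. 4.14. [Sprung2017]
* R. Greenberg, *Iwasawa theory for elliptic curves*, LNM 1716 (1999), §1 (pp. 67–68), §5 p. 181.
  [GreenbergLNM1716]
* B. Mazur, J. Tate, J. Teitelbaum, Invent. Math. 84 (1986), §I.17. [MazurTateTeitelbaum1986Invent]
-/

noncomputable section

open scoped MatrixGroups ModularForm

open CongruenceSubgroup PowerSeries Filter Topology
  Literature.NumberTheory.EllipticCurves Literature.NumberTheory.EllipticCurves.ModularForms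
  Literature.NumberTheory.EllipticCurves.Sprung2017

namespace Literature.Barriers.BirchSwinnertonDyer

/-! ### §1. `2`-adic bookkeeping -/

section Prelim

/-- `‖n − c‖₂ ≤ ½` for `n ∈ ℕ`, `c ∈ ℤ₂` means `(n : ℤ/2) = c mod 2`. [folklore] -/
private theorem natCast_eq_toZModPow_one_of_norm_sub_le_half {n : ℕ} {c : ℤ_[2]}
    (h : ‖(n : ℚ_[2]) - (c : ℚ_[2])‖ ≤ 2⁻¹) : (n : ZMod 2) = PadicInt.toZModPow 1 c := by
  have hlt : ‖((n : ℤ_[2]) - c : ℤ_[2])‖ < 1 := by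
    rw [PadicInt.norm_def, PadicInt.coe_sub, PadicInt.coe_natCast]
    exact h.trans_lt (by norm_num)
  have hdvd : ((2 : ℕ) : ℤ_[2]) ∣ (n : ℤ_[2]) - c := (PadicInt.norm_lt_one_iff_dvd _).mp hlt
  have hker : ((n : ℤ_[2]) - c) ∈ RingHom.ker (PadicInt.toZModPow (p := 2) 1) := by
    rw [PadicInt.ker_toZModPow, Ideal.mem_span_singleton, pow_one]
    exact hdvd
  rw [RingHom.mem_ker, map_sub, map_natCast, sub_eq_zero] at hker
  exact hker

/-- `a = −2/3` is even: `a mod 2 = 0` (from `3a = −2`). [folklore] -/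
private theorem toZModPow_one_eq_zero_of_three_mul_eq {a : ℤ_[2]} (ha : 3 * a = -2) :
    PadicInt.toZModPow 1 a = 0 := by
  have h := congrArg (PadicInt.toZModPow (p := 2) 1) ha
  rw [map_mul, map_neg, map_ofNat, map_ofNat] at h
  have h3 : (3 : ZMod (2 ^ 1)) = 1 := by decide
  have h2 : (2 : ZMod (2 ^ 1)) = 0 := by decide
  rw [h3, one_mul, h2, neg_zero] at h
  exact h

/-- `b = −1/3` is odd: `b mod 2 = 1` (from `3b = −1`). [folklore] -/
private theorem toZModPow_one_eq_one_of_three_mul_eq {b : ℤ_[2]} (hb : 3 * b = -1) :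
    PadicInt.toZModPow 1 b = 1 := by
  have h := congrArg (PadicInt.toZModPow (p := 2) 1) hb
  rw [map_mul, map_neg, map_ofNat, map_one] at h
  have h3 : (3 : ZMod (2 ^ 1)) = 1 := by decide
  have h1 : (-1 : ZMod (2 ^ 1)) = 1 := by decide
  rw [h3, one_mul, h1] at h
  exact h

/-- `N ≡ η 5^c (mod 8)` with `η = ±1`: `c` is even iff `N ≡ ±1 (mod 8)`, odd iff `N ≡ ±3 (mod 8)`.
[folklore] -/
private theorem toZModPow_one_iff_mod_eight {N : ℕ} {ηN : rootsOfUnity (torsionOrder 2) ℤ_[2]}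
    {c : ℤ_[2]}
    (hc : ∀ n : ℕ, PadicInt.toZModPow (n + cyclotomicExponent 2) ((ηN : ℤ_[2]ˣ) : ℤ_[2]) *
      (cyclotomicGenerator 2 : ZMod (2 ^ (n + cyclotomicExponent 2))) ^
        (PadicInt.toZModPow n c).val = (N : ZMod (2 ^ (n + cyclotomicExponent 2)))) :
    (PadicInt.toZModPow 1 c = 0 ↔ (N % 8 = 1 ∨ N % 8 = 7)) ∧
      (PadicInt.toZModPow 1 c + 1 = 0 ↔ (N % 8 = 3 ∨ N % 8 = 5)) := by
  -- `η = ±1`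
  have hη : ((ηN : ℤ_[2]ˣ) : ℤ_[2]) = 1 ∨ ((ηN : ℤ_[2]ˣ) : ℤ_[2]) = -1 := by
    have h := ηN.2
    rw [mem_rootsOfUnity] at h
    have h' : (((ηN : ℤ_[2]ˣ) : ℤ_[2])) ^ torsionOrder 2 = 1 := by
      rw [← Units.val_pow_eq_pow_val, h, Units.val_one]
    generalize ((ηN : ℤ_[2]ˣ) : ℤ_[2]) = x at h' ⊢
    rw [torsionOrder_two] at h'
    exact sq_eq_one_iff.mp h'
  -- `N ≡ η · 5^{c mod 2} (mod 8)`
  have h8 : PadicInt.toZModPow 3 ((ηN : ℤ_[2]ˣ) : ℤ_[2]) *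
      (5 : ZMod 8) ^ (PadicInt.toZModPow 1 c).val = ((N : ℕ) : ZMod 8) := by
    have h := hc 1
    rw [cyclotomicGenerator_two] at h
    exact_mod_cast h
  have hη8 : PadicInt.toZModPow 3 ((ηN : ℤ_[2]ˣ) : ℤ_[2]) = 1 ∨
      PadicInt.toZModPow 3 ((ηN : ℤ_[2]ˣ) : ℤ_[2]) = -1 := by
    rcases hη with h | h
    · exact Or.inl (by rw [h, map_one])
    · exact Or.inr (by rw [h, map_neg, map_one])
  have hN8 : N % 8 = (((N : ℕ) : ZMod 8)).val := by
    rw [ZMod.val_natCast]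
  have h0 : ∀ x : ZMod (2 ^ 1), (x = 0 ↔ x.val = 0) := by decide
  have h1 : ∀ x : ZMod (2 ^ 1), (x + 1 = 0 ↔ x.val = 1) := by decide
  rw [h0, h1, hN8, ← h8]
  set v : ℕ := (PadicInt.toZModPow 1 c).val with hv
  have hvlt : v < 2 := ZMod.val_lt _
  interval_cases v
  · rcases hη8 with h | h <;> rw [h] <;> decide
  · rcases hη8 with h | h <;> rw [h] <;> decide

/-- `ι_Λ((1+T)^x) = (1+T)^x` (binomial series with `ℤ_p`-exponent read in `ℚ_p`). [folklore] -/
private theorem iwasawaToPowerSeries_binomialSeries' {p : ℕ} [Fact p.Prime] (x : ℤ_[p]) :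
    iwasawaToPowerSeries p (PowerSeries.binomialSeries ℤ_[p] x) =
      PowerSeries.binomialSeries ℚ_[p] x := by
  change PowerSeries.map (algebraMap ℤ_[p] ℚ_[p]) _ = _
  ext n
  rw [coeff_map, binomialSeries_coeff, binomialSeries_coeff, smul_eq_mul, mul_one, Algebra.smul_def,
    mul_one]

/-- Reading `L(T^ι) = σ(1+T)^x L` (in `Λ`) in `ℚ_p⟦T⟧`, for `t · ι_Λ L` (`t ∈ ℚ_p`):
`(t ι_Λ L)(T^ι) = C σ · (1+T)^x · (t ι_Λ L)`. [folklore] -/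
private theorem subst_C_mul_iwasawaToPowerSeries_eq {p : ℕ} [Fact p.Prime] {σ : ℤ} {x : ℤ_[p]}
    {L : IwasawaAlgebra p} (h : L.subst (invOnePlusSubOne : ℤ_[p]⟦X⟧) =
      (σ : IwasawaAlgebra p) * PowerSeries.binomialSeries ℤ_[p] x * L) (t : ℚ_[p]) :
    (C t * iwasawaToPowerSeries p L).subst (invOnePlusSubOne : ℚ_[p]⟦X⟧) =
      C ((σ : ℤ) : ℚ_[p]) * PowerSeries.binomialSeries ℚ_[p] x *
        (C t * iwasawaToPowerSeries p L) := by
  have hιmap : MvPowerSeries.map (algebraMap ℤ_[p] ℚ_[p]) (invOnePlusSubOne : ℤ_[p]⟦X⟧) =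
      (invOnePlusSubOne : ℚ_[p]⟦X⟧) := by
    show PowerSeries.map (algebraMap ℤ_[p] ℚ_[p]) (invOnePlusSubOne : ℤ_[p]⟦X⟧) = invOnePlusSubOne
    ext n
    simp only [coeff_map, coeff_invOnePlusSubOne]
    split_ifs <;> simp
  have hK : (iwasawaToPowerSeries p L).subst (invOnePlusSubOne : ℚ_[p]⟦X⟧) =
      C ((σ : ℤ) : ℚ_[p]) * PowerSeries.binomialSeries ℚ_[p] x * iwasawaToPowerSeries p L := by
    have hm := map_subst (hasSubst_invOnePlusSubOne (R := ℤ_[p])) (h := algebraMap ℤ_[p] ℚ_[p]) L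
    rw [hιmap] at hm
    change iwasawaToPowerSeries p (L.subst invOnePlusSubOne) = (iwasawaToPowerSeries p L).subst _
      at hm
    rw [← hm, h, map_mul, map_mul, map_intCast, iwasawaToPowerSeries_binomialSeries',
      ← map_intCast (C : ℚ_[p] →+* ℚ_[p]⟦X⟧) σ]
  rw [← smul_eq_C_mul, subst_smul hasSubst_invOnePlusSubOne t (iwasawaToPowerSeries p L), hK,
    smul_eq_C_mul, smul_eq_C_mul]
  ring

/-- The coefficients of `ι_Λ L`, `L ∈ Λ`, are `2`-integral. [folklore] -/
private theorem norm_coeff_iwasawaToPowerSeries {p : ℕ} [Fact p.Prime] (L : IwasawaAlgebra p)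
    (k : ℕ) : ‖coeff k (iwasawaToPowerSeries p L)‖ = ‖coeff k L‖ := by
  rw [iwasawaToPowerSeries, coeff_map, PadicInt.algebraMap_apply, PadicInt.norm_def]

end Prelim

/-! ### §2. PARITY(2) for `L♯₂` and `L♭₂` (`a₂ = 0`) -/

section Curve

variable {W : WeierstrassCurve ℚ} [W.IsElliptic] [W.IsGloballyMinimal] {N : ℕ} [NeZero N]
  {f : CuspForm (Gamma0 N) 2}

/-- **PARITY(2)♯: `(−1)^{λ♯} = χ₈(N)` at a supersingular `2` with `a₂ = 0`.** Let `E = W/ℚ` be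
globally minimal, good supersingular at `2` with `a₂(E) = 0`, `f ∈ S₂(Γ₀(N))` its newform
(`N = N_E` at the conductor level), `(L♯, L♭)` Sprung's pair (`IsSprungPair f 2 0 L♯ L♭`), and
`t ∈ ℚ₂` a scalar with `t · L♯` `2`-integral (`t = 1` works; `t = 2^{−μ}` normalises). If `n` is
the index of the first UNIT coefficient of `t · L♯` — for `t = 2^{−μ(L♯)}` this is `λ(L♯)` — then
`n` is even iff `N ≡ ±1 (mod 8)`; the root number does not enter. Inputs: the functional equation
`L♯(T^ι) = σ(1+T)^{c+a}L♯`, `3a = −2` (`exists_functionalEquation_sharp_flat_two`; Sprung's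
`W⁺ = (1+T)^{2/3}`), the core `norm_natCast_sub_le_of_subst_invOnePlusSubOne_eq` (`n ≡ c + a`),
`a ≡ 0 (mod 2)`, and `5^c ≡ 1 (mod 8) ↔ c` even, `η_N = ±1`.
[cite: Sprung2017, Cor. 4.14 and §3.5 (functional equation of `L♯`, `a_p = 0`)]
[cite: GreenbergLNM1716, §1 (pp. 67–68) and §5 p. 181] -/
theorem even_firstUnitCoeff_sharp_iff_mod_eight (hf : IsNewformOf W f)
    (hgood : W.HasGoodReductionAtPrime 2) (ha0 : W.frobeniusTrace 2 = 0) {Ls Lf : IwasawaAlgebra 2}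
    (h : IsSprungPair f 2 0 Ls Lf) (t : ℚ_[2]) {n : ℕ}
    (hint : ∀ k, ‖coeff k (C t * iwasawaToPowerSeries 2 Ls)‖ ≤ 1)
    (hsmall : ∀ j < n, ‖coeff j (C t * iwasawaToPowerSeries 2 Ls)‖ ≤ 2⁻¹)
    (hunit : ‖coeff n (C t * iwasawaToPowerSeries 2 Ls)‖ = 1) :
    Even n ↔ (N % 8 = 1 ∨ N % 8 = 7) := by
  obtain ⟨σ, hσ1, -, ηN, c, a, b, hc, ha, -, hFE⟩ :=
    exists_functionalEquation_sharp_flat_two hf hgood ha0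
  obtain ⟨hs, -⟩ := hFE Ls Lf h
  have hFEg := subst_C_mul_iwasawaToPowerSeries_eq hs t
  have hσ : ((σ : ℤ) : ℚ_[2]) = 1 ∨ ((σ : ℤ) : ℚ_[2]) = -1 := by
    rcases hσ1 with h | h <;> simp [h]
  have hpar := natCast_eq_toZModPow_one_of_norm_sub_le_half
    (norm_natCast_sub_le_of_subst_invOnePlusSubOne_eq hσ hFEg hint hsmall hunit)
  rw [map_add, toZModPow_one_eq_zero_of_three_mul_eq ha, add_zero] at hpar
  rw [← ZMod.natCast_eq_zero_iff_even, hpar]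
  exact (toZModPow_one_iff_mod_eight hc).1

/-- **PARITY(2)♭: `(−1)^{λ♭} = −χ₈(N)` at a supersingular `2` with `a₂ = 0`.** With the notation
of `even_firstUnitCoeff_sharp_iff_mod_eight`, if `n` is the index of the first unit coefficient of
`t · L♭` (`t · L♭` `2`-integral), then `n` is even iff `N ≡ ±3 (mod 8)`. Inputs: the functional
equation `L♭(T^ι) = σ(1+T)^{c+b}L♭`, `3b = −1` (Sprung's `W⁻ = (1+T)^{1/3}` at `p = 2`), the core
(`n ≡ c + b`), `b ≡ 1 (mod 2)`.
[cite: Sprung2017, Cor. 4.14 and §3.5 (functional equation of `L♭`, `a_p = 0`, `p = 2`)]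
[cite: GreenbergLNM1716, §1 (pp. 67–68) and §5 p. 181] -/
theorem even_firstUnitCoeff_flat_iff_mod_eight (hf : IsNewformOf W f)
    (hgood : W.HasGoodReductionAtPrime 2) (ha0 : W.frobeniusTrace 2 = 0) {Ls Lf : IwasawaAlgebra 2}
    (h : IsSprungPair f 2 0 Ls Lf) (t : ℚ_[2]) {n : ℕ}
    (hint : ∀ k, ‖coeff k (C t * iwasawaToPowerSeries 2 Lf)‖ ≤ 1)
    (hsmall : ∀ j < n, ‖coeff j (C t * iwasawaToPowerSeries 2 Lf)‖ ≤ 2⁻¹)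
    (hunit : ‖coeff n (C t * iwasawaToPowerSeries 2 Lf)‖ = 1) :
    Even n ↔ (N % 8 = 3 ∨ N % 8 = 5) := by
  obtain ⟨σ, hσ1, -, ηN, c, a, b, hc, -, hb, hFE⟩ :=
    exists_functionalEquation_sharp_flat_two hf hgood ha0
  obtain ⟨-, hs⟩ := hFE Ls Lf h
  have hFEg := subst_C_mul_iwasawaToPowerSeries_eq hs t
  have hσ : ((σ : ℤ) : ℚ_[2]) = 1 ∨ ((σ : ℤ) : ℚ_[2]) = -1 := by
    rcases hσ1 with h | h <;> simp [h]
  have hpar := natCast_eq_toZModPow_one_of_norm_sub_le_half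
    (norm_natCast_sub_le_of_subst_invOnePlusSubOne_eq hσ hFEg hint hsmall hunit)
  rw [map_add, toZModPow_one_eq_one_of_three_mul_eq hb] at hpar
  rw [← ZMod.natCast_eq_zero_iff_even, hpar]
  exact (toZModPow_one_iff_mod_eight hc).2

/-- **`λ♯ + λ♭` is ODD at a supersingular `2` with `a₂ = 0`** (first-unit-coefficient form): with
`n♯`, `n♭` the indices of the first unit coefficients of `t♯ · L♯` and `t♭ · L♭`, `n♯ + n♭` is odd
(`N` is odd: `2 ∤ N` by good reduction at `2`). [cite: Sprung2017, Cor. 4.14 and §3.5]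
[cite: GreenbergLNM1716, §5 p. 181] -/
theorem odd_firstUnitCoeff_sharp_add_flat (hf : IsNewformOf W f)
    (hgood : W.HasGoodReductionAtPrime 2) (ha0 : W.frobeniusTrace 2 = 0) {Ls Lf : IwasawaAlgebra 2}
    (h : IsSprungPair f 2 0 Ls Lf) (ts tf : ℚ_[2]) {ns nf : ℕ}
    (hints : ∀ k, ‖coeff k (C ts * iwasawaToPowerSeries 2 Ls)‖ ≤ 1)
    (hsmalls : ∀ j < ns, ‖coeff j (C ts * iwasawaToPowerSeries 2 Ls)‖ ≤ 2⁻¹)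
    (hunits : ‖coeff ns (C ts * iwasawaToPowerSeries 2 Ls)‖ = 1)
    (hintf : ∀ k, ‖coeff k (C tf * iwasawaToPowerSeries 2 Lf)‖ ≤ 1)
    (hsmallf : ∀ j < nf, ‖coeff j (C tf * iwasawaToPowerSeries 2 Lf)‖ ≤ 2⁻¹)
    (hunitf : ‖coeff nf (C tf * iwasawaToPowerSeries 2 Lf)‖ = 1) :
    Odd (ns + nf) := by
  have hN : ¬ 2 ∣ N := not_dvd_level_of_isNewformOf hf hgood
  have hs := even_firstUnitCoeff_sharp_iff_mod_eight hf hgood ha0 h ts hints hsmalls hunits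
  have hf' := even_firstUnitCoeff_flat_iff_mod_eight hf hgood ha0 h tf hintf hsmallf hunitf
  rw [Nat.odd_add, ← Nat.not_even_iff_odd, hs, hf']
  omega

/-- **PARITY(2)♯ at `μ = 0`** (no normalising scalar): if the `n`-th coefficient of `L♯ ∈ ℤ₂⟦T⟧`
is its first UNIT coefficient (`μ(L♯) = 0`, `λ(L♯) = n`), then `n` is even iff `N ≡ ±1 (mod 8)`.
[cite: Sprung2017, Cor. 4.14 and §3.5] [cite: GreenbergLNM1716, §1 (pp. 67–68) and §5 p. 181] -/
theorem even_firstUnitCoeff_sharp_iff_mod_eight_of_mu_zero (hf : IsNewformOf W f)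
    (hgood : W.HasGoodReductionAtPrime 2) (ha0 : W.frobeniusTrace 2 = 0) {Ls Lf : IwasawaAlgebra 2}
    (h : IsSprungPair f 2 0 Ls Lf) {n : ℕ} (hsmall : ∀ j < n, ‖coeff j Ls‖ ≤ 2⁻¹)
    (hunit : ‖coeff n Ls‖ = 1) : Even n ↔ (N % 8 = 1 ∨ N % 8 = 7) := by
  refine even_firstUnitCoeff_sharp_iff_mod_eight hf hgood ha0 h 1 (n := n) ?_ ?_ ?_
  · intro k
    rw [map_one, one_mul, norm_coeff_iwasawaToPowerSeries]
    exact PadicInt.norm_le_one _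
  · intro j hj
    rw [map_one, one_mul, norm_coeff_iwasawaToPowerSeries]
    exact hsmall j hj
  · rw [map_one, one_mul, norm_coeff_iwasawaToPowerSeries]
    exact hunit

/-- **PARITY(2)♭ at `μ = 0`**: if the `n`-th coefficient of `L♭ ∈ ℤ₂⟦T⟧` is its first unit
coefficient, then `n` is even iff `N ≡ ±3 (mod 8)`.
[cite: Sprung2017, Cor. 4.14 and §3.5] [cite: GreenbergLNM1716, §1 (pp. 67–68) and §5 p. 181] -/
theorem even_firstUnitCoeff_flat_iff_mod_eight_of_mu_zero (hf : IsNewformOf W f)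
    (hgood : W.HasGoodReductionAtPrime 2) (ha0 : W.frobeniusTrace 2 = 0) {Ls Lf : IwasawaAlgebra 2}
    (h : IsSprungPair f 2 0 Ls Lf) {n : ℕ} (hsmall : ∀ j < n, ‖coeff j Lf‖ ≤ 2⁻¹)
    (hunit : ‖coeff n Lf‖ = 1) : Even n ↔ (N % 8 = 3 ∨ N % 8 = 5) := by
  refine even_firstUnitCoeff_flat_iff_mod_eight hf hgood ha0 h 1 (n := n) ?_ ?_ ?_
  · intro k
    rw [map_one, one_mul, norm_coeff_iwasawaToPowerSeries]
    exact PadicInt.norm_le_one _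
  · intro j hj
    rw [map_one, one_mul, norm_coeff_iwasawaToPowerSeries]
    exact hsmall j hj
  · rw [map_one, one_mul, norm_coeff_iwasawaToPowerSeries]
    exact hunit

/-- **`λ(L♯) + λ(L♭)` is odd at `μ = 0`** (`2` supersingular, `a₂ = 0`).
[cite: Sprung2017, Cor. 4.14 and §3.5] [cite: GreenbergLNM1716, §5 p. 181] -/
theorem odd_firstUnitCoeff_sharp_add_flat_of_mu_zero (hf : IsNewformOf W f)
    (hgood : W.HasGoodReductionAtPrime 2) (ha0 : W.frobeniusTrace 2 = 0) {Ls Lf : IwasawaAlgebra 2}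
    (h : IsSprungPair f 2 0 Ls Lf) {ns nf : ℕ} (hsmalls : ∀ j < ns, ‖coeff j Ls‖ ≤ 2⁻¹)
    (hunits : ‖coeff ns Ls‖ = 1) (hsmallf : ∀ j < nf, ‖coeff j Lf‖ ≤ 2⁻¹)
    (hunitf : ‖coeff nf Lf‖ = 1) : Odd (ns + nf) := by
  have hN : ¬ 2 ∣ N := not_dvd_level_of_isNewformOf hf hgood
  have hs := even_firstUnitCoeff_sharp_iff_mod_eight_of_mu_zero hf hgood ha0 h hsmalls hunits
  have hf' := even_firstUnitCoeff_flat_iff_mod_eight_of_mu_zero hf hgood ha0 h hsmallf hunitf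
  rw [Nat.odd_add, ← Nat.not_even_iff_odd, hs, hf']
  omega

end Curve

end Literature.Barriers.BirchSwinnertonDyer

end
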